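import Summits.ResolutionOfSingularities.ResolutionOfSingularities.Theorems.WildQuotientsWildQuotientResolutionToricChartMonomialIdeals
import Summits.ResolutionOfSingularities.ResolutionOfSingularities.Theorems.WildQuotientsWildQuotientResolutionToricChartLemmas
import Summits.ResolutionOfSingularities.ResolutionOfSingularities.Theorems.WildQuotientsWildQuotientResolutionToricChartWords
import Summits.ResolutionOfSingularities.ResolutionOfSingularities.Theorems.WildQuotientsWildQuotientResolutionToricChartNoetherian
import Literature.AlgebraicGeometry.Resolution.AffineDomainDimension
import HarnessLib

/-!
# THE CONE POINT OF A TORIC CONE RING IS SINGULAR when the cone has more indecomposable generators than its dimension — point derivations via dual numbers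
# (crux `FInjectiveMacaulayfication` stmt-ResolutionOfSingularities-15315, chain w45a, door v41.1; #3b legality (B-M) of res-L1-w45a-plan-1's RULING R23.7; seat res-L1-w45a-lead-1 g12)

[OURS · L1 W4.5a] Support file (`--supports stmt-ResolutionOfSingularities-15315 --as helper`); replaces the role of NO printed item; NOT a statement of any manuscript;
def-free; UNCONDITIONAL; no named fact. AI-written (AI review is weaker than expert review).

For a presented cone ring `A = ToricChart.Ring k PEmpty D` (res-L1-w45c-stub-4's `ToricChart` currency) and symbol words `U : Fin n → Word d r` with pairwise distinct, non-zero,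
INDECOMPOSABLE exponents (`wordExp w + wordExp w′ = wordExp (U i) ⇒` one summand is `0`) generating a MAXIMAL ideal `𝔪` (the cone point): if `d < n` then `A_𝔪` is NOT a
regular local ring. Proof (Zariski tangent space): the coefficient of `x^{U i}` in `θ a` is a point derivation `δ_i : A → k` at `𝔪` (Leibniz by indecomposability), so
`a ↦ χ(a) + δ_i(a)ε` is a ring map `A → k[ε]` sending `A ∖ 𝔪` to units; it extends to `A_𝔪` (`IsLocalization.lift`); the `k`-linear test `z ↦ (ε-part of ψ_i z)_i ∈ kⁿ` maps the
maximal ideal into the span of the images of ANY generating set and hits the standard basis (`δ_i(U j) = δ_{ij}`), so `𝔪A_𝔪` needs `≥ n` generators; a regular `A_𝔪` has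
`spanFinrank 𝔪 = dim A_𝔪 = height 𝔪 ≤ dim A = trdeg_k A ≤ d < n` (`θ : A ↪ k[x₁..x_d]`; tree `exists_ringKrullDim_eq_and_trdeg_eq`). Consumer: the legality file of the
recurrent-monoid T″-instance (cone point of `U_R`: 7 generators in dimension 4; the transversal node over `k(t)`: 4 generators in dimension 3).

* `coeff_theta_mul_of_indecomposable` — the Leibniz rule of the coefficient functional at an indecomposable exponent;
* `exists_ringHom_dualNumber` — the point derivation packaged as a ring map `A → k[ε]`;
* ★ `not_isRegularLocalRing_conePoint` — the theorem above.
[folklore; cite: Matsumura1987, §14 (embedding dimension), Thm. 5.6 (dimension of affine domains)]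
-/

-- single-problem summit: the doubled namespace component is forced
set_option linter.dupNamespace false

noncomputable section

namespace Summit.ResolutionOfSingularities.ResolutionOfSingularities.Theorems.FInjectiveMacaulayfication.ToricConePoint

open MvPolynomial IsLocalRing
open Literature.AlgebraicGeometry.Resolution
open Summit.ResolutionOfSingularities.ResolutionOfSingularities.Theorems.WildQuotientResolution.ToricChart

variable (k : Type) [Field k] {d r : ℕ} (D : ConeDatum d r)

/-! ## §1 Exponents of `θ a` are word exponents (no passengers) -/

/-- Without passengers every exponent is the `ιexp` of its distinguished part. [plumbing] -/
theorem ιexp_dist_eq (m : (Fin d ⊕ PEmpty) →₀ ℕ) : ιexp PEmpty (dist m) = m := by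
  ext v
  rcases v with s | p
  · rw [ιexp_inl]; rfl
  · exact p.elim

/-- `ιexp` is injective and `ιexp 0 = 0`. [plumbing] -/
theorem ιexp_injective {e₁ e₂ : Fin d → ℕ} (h : ιexp PEmpty e₁ = ιexp PEmpty e₂) : e₁ = e₂ := by
  rw [← dist_ιexp (P := PEmpty) e₁, ← dist_ιexp (P := PEmpty) e₂, h]

/-- `ιexp 0 = 0`. [plumbing] -/
theorem ιexp_zero : ιexp PEmpty (0 : Fin d → ℕ) = 0 := by
  ext v
  rcases v with s | p
  · rw [ιexp_inl]; rfl
  · exact p.elim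

/-- Every monomial of `θ a` is `x^{wordExp w}` for a word `w`. [plumbing over `ToricChart.exists_word_of_mem_support`] -/
theorem exists_word_eq_ιexp (a : Ring k PEmpty D) (m : (Fin d ⊕ PEmpty) →₀ ℕ) (hm : m ∈ (theta a).support) :
    ∃ w : Word d r, ιexp PEmpty (wordExp D w) = m := by
  obtain ⟨w, hw⟩ := exists_word_of_mem_support a m hm
  exact ⟨w, by rw [hw, ιexp_dist_eq]⟩

/-! ## §2 The coefficient functional at an indecomposable exponent is a point derivation -/

/-- ★ **Leibniz rule.** If the exponent `e ≠ 0` is INDECOMPOSABLE among word exponents (`wordExp w + wordExp w′ = e ⇒` one of them is `0`), then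
`coeff_e θ(ab) = coeff_e θ(a) · coeff_0 θ(b) + coeff_0 θ(a) · coeff_e θ(b)`. [folklore] -/
theorem coeff_theta_mul_of_indecomposable (e : Fin d → ℕ) (he : e ≠ 0)
    (hind : ∀ w w' : Word d r, wordExp D w + wordExp D w' = e → wordExp D w = 0 ∨ wordExp D w' = 0) (a b : Ring k PEmpty D) :
    coeff (ιexp PEmpty e) (theta (a * b)) =
      coeff (ιexp PEmpty e) (theta a) * coeff 0 (theta b) + coeff 0 (theta a) * coeff (ιexp PEmpty e) (theta b) := by
  classical
  have hne : ιexp PEmpty e ≠ 0 := fun h0 => he (ιexp_injective (by rw [h0, ιexp_zero]))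
  rw [map_mul, coeff_mul, Finset.sum_eq_add_of_mem (ιexp PEmpty e, (0 : (Fin d ⊕ PEmpty) →₀ ℕ)) ((0 : (Fin d ⊕ PEmpty) →₀ ℕ), ιexp PEmpty e)
    (by rw [Finset.HasAntidiagonal.mem_antidiagonal, add_zero]) (by rw [Finset.HasAntidiagonal.mem_antidiagonal, zero_add]) (fun h => hne (Prod.mk.inj h).1)]
  rintro ⟨m₁, m₂⟩ hm ⟨h1, h2⟩
  simp only [Finset.HasAntidiagonal.mem_antidiagonal] at hm
  -- a summand with both coefficients non-zero splits `e` into two word exponents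
  by_contra hprod
  have hc1 : coeff m₁ (theta a) ≠ 0 := fun h0 => hprod (by rw [h0, zero_mul])
  have hc2 : coeff m₂ (theta b) ≠ 0 := fun h0 => hprod (by rw [h0, mul_zero])
  obtain ⟨w₁, hw₁⟩ := exists_word_eq_ιexp k D a m₁ (mem_support_iff.mpr hc1)
  obtain ⟨w₂, hw₂⟩ := exists_word_eq_ιexp k D b m₂ (mem_support_iff.mpr hc2)
  have hsum : wordExp D w₁ + wordExp D w₂ = e := by
    apply ιexp_injective
    rw [ιexp_add, hw₁, hw₂, hm]
  rcases hind w₁ w₂ hsum with h0 | h0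
  · apply h2
    have hm₁ : m₁ = 0 := by rw [← hw₁, h0, ιexp_zero]
    rw [hm₁, zero_add] at hm
    rw [hm₁, hm]
  · apply h1
    have hm₂ : m₂ = 0 := by rw [← hw₂, h0, ιexp_zero]
    rw [hm₂, add_zero] at hm
    rw [hm₂, hm]

/-- **The point derivation as a ring map to the dual numbers**: for an indecomposable non-zero exponent `e`, `a ↦ (θa)(0) + coeff_e(θa)·ε` is a ring homomorphism
`A → k[ε]`. [folklore] -/
theorem exists_ringHom_dualNumber (e : Fin d → ℕ) (he : e ≠ 0)
    (hind : ∀ w w' : Word d r, wordExp D w + wordExp D w' = e → wordExp D w = 0 ∨ wordExp D w' = 0) :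
    ∃ φ : Ring k PEmpty D →+* DualNumber k, ∀ a, (φ a).fst = coeff 0 (theta a) ∧ (φ a).snd = coeff (ιexp PEmpty e) (theta a) := by
  classical
  have hne : ιexp PEmpty e ≠ 0 := fun h0 => he (ιexp_injective (by rw [h0, ιexp_zero]))
  refine ⟨{ toFun := fun a => (TrivSqZeroExt.inl (coeff 0 (theta a)) : DualNumber k) + TrivSqZeroExt.inr (coeff (ιexp PEmpty e) (theta a))
            map_one' := ?_, map_mul' := ?_, map_zero' := ?_, map_add' := ?_ }, fun a => ⟨by simp, by simp⟩⟩
  · ext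
    · rw [TrivSqZeroExt.fst_add, TrivSqZeroExt.fst_inl, TrivSqZeroExt.fst_inr, add_zero, TrivSqZeroExt.fst_one, map_one, coeff_one, if_pos rfl]
    · simp only [map_one, coeff_one, TrivSqZeroExt.snd_add, TrivSqZeroExt.snd_inl, TrivSqZeroExt.snd_inr, zero_add, TrivSqZeroExt.snd_one]
      rw [if_neg fun h0 => hne h0.symm]
  · intro a b
    ext
    · simp only [TrivSqZeroExt.fst_add, TrivSqZeroExt.fst_inl, TrivSqZeroExt.fst_inr, add_zero, TrivSqZeroExt.fst_mul, map_mul]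
      rw [coeff_mul, Finset.sum_eq_single ((0 : (Fin d ⊕ PEmpty) →₀ ℕ), (0 : (Fin d ⊕ PEmpty) →₀ ℕ))]
      · rintro ⟨m₁, m₂⟩ hm hne'
        simp only [Finset.HasAntidiagonal.mem_antidiagonal] at hm
        exfalso; apply hne'
        have h1 : m₁ = 0 := by
          ext v
          have := DFunLike.congr_fun hm v
          simp only [Finsupp.add_apply, Finsupp.coe_zero, Pi.zero_apply] at this
          rw [Finsupp.coe_zero, Pi.zero_apply]
          omega
        rw [h1, zero_add] at hm
        rw [h1, hm]
      · intro h0; exact absurd (by rw [Finset.HasAntidiagonal.mem_antidiagonal, add_zero]) h0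
    · simp only [TrivSqZeroExt.snd_add, TrivSqZeroExt.snd_inl, TrivSqZeroExt.snd_inr, zero_add, DualNumber.snd_mul, TrivSqZeroExt.fst_add, TrivSqZeroExt.fst_inl,
        TrivSqZeroExt.fst_inr, add_zero]
      rw [coeff_theta_mul_of_indecomposable k D e he hind a b]
      ring
  · ext
    · simp only [map_zero, coeff_zero, TrivSqZeroExt.fst_add, TrivSqZeroExt.fst_inl, TrivSqZeroExt.fst_inr, add_zero, TrivSqZeroExt.fst_zero]
    · simp only [map_zero, coeff_zero, TrivSqZeroExt.snd_add, TrivSqZeroExt.snd_inl, TrivSqZeroExt.snd_inr, add_zero, TrivSqZeroExt.snd_zero]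
  · intro a b
    ext
    · simp only [map_add, coeff_add, TrivSqZeroExt.fst_add, TrivSqZeroExt.fst_inl, TrivSqZeroExt.fst_inr, add_zero]
    · simp only [map_add, coeff_add, TrivSqZeroExt.snd_add, TrivSqZeroExt.snd_inl, TrivSqZeroExt.snd_inr, zero_add]

/-! ## §3 The cone point is singular -/

/-- ★★ **THE CONE POINT IS NOT REGULAR.** Let `U : Fin n → Word d r` be symbol words of `A = ToricChart.Ring k PEmpty D` with pairwise distinct, non-zero, indecomposable
exponents, generating a maximal ideal `𝔪 = spanWords U`. If `d < n` then `A_𝔪` is NOT a regular local ring: the `n` point derivations «coefficient of `x^{U i}`» extend to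
`A_𝔪 → k[ε]` and force `≥ n` generators of `𝔪A_𝔪`, while `dim A_𝔪 ≤ dim A = trdeg_k A ≤ d`. [OURS; folklore: the Zariski tangent space of a toric cone point;
cite: Matsumura1987, §14, Thm. 5.6] -/
theorem not_isRegularLocalRing_conePoint {n : ℕ} (U : Fin n → Word d r) (hdn : d < n)
    (hdist : ∀ i j, wordExp D (U i) = wordExp D (U j) → i = j) (hU0 : ∀ i, wordExp D (U i) ≠ 0)
    (hind : ∀ i (w w' : Word d r), wordExp D w + wordExp D w' = wordExp D (U i) → wordExp D w = 0 ∨ wordExp D w' = 0)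
    (hmax : (spanWords k PEmpty D U).IsMaximal) :
    ¬ IsRegularLocalRing (Localization.AtPrime (spanWords k PEmpty D U)) := by
  classical
  intro hreg
  haveI : IsDomain (Ring k PEmpty D) := isDomain_ring
  haveI : IsNoetherianRing (Ring k PEmpty D) := isNoetherianRing_ring k PEmpty D
  haveI : (spanWords k PEmpty D U).IsMaximal := hmax
  haveI : IsRegularLocalRing (Localization.AtPrime (spanWords k PEmpty D U)) := hreg
  have hιne : ∀ i, ιexp PEmpty (wordExp D (U i)) ≠ 0 := fun i h0 => hU0 i (ιexp_injective (by rw [h0, ιexp_zero]))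
  -- (1) the character `χ = ev₀ ∘ θ`: `𝔪 = ker χ`, so `A ∖ 𝔪` maps to units
  let χ : Ring k PEmpty D →+* k := (MvPolynomial.eval (0 : Fin d ⊕ PEmpty → k)).comp (theta (k := k) (P := PEmpty) (D := D)).toRingHom
  have hχ : ∀ a, χ a = coeff 0 (theta a) := fun a => by
    show MvPolynomial.eval (0 : Fin d ⊕ PEmpty → k) (theta a) = _
    rw [MvPolynomial.eval_zero, MvPolynomial.constantCoeff_eq]
  have h𝔪χ : spanWords k PEmpty D U ≤ RingHom.ker χ := by
    rw [spanWords, Ideal.span_le]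
    rintro _ ⟨i, rfl⟩
    show χ (wordElem k PEmpty D (U i)) = 0
    rw [hχ, theta_wordElem, xmon_eq_monomial, coeff_monomial, if_neg (hιne i)]
  have hkerχ : RingHom.ker χ = spanWords k PEmpty D U := (hmax.eq_of_le (RingHom.ker_ne_top χ) h𝔪χ).symm
  have hunitχ : ∀ y : (spanWords k PEmpty D U).primeCompl, IsUnit (χ y) := by
    intro y
    rw [isUnit_iff_ne_zero]
    intro h0
    have hy : (y : Ring k PEmpty D) ∈ RingHom.ker χ := h0
    rw [hkerχ] at hy
    exact y.2 hy
  -- (2) the point derivations as ring maps `A → k[ε]`, extended to `A_𝔪`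
  have hφ := fun i => exists_ringHom_dualNumber k D (wordExp D (U i)) (hU0 i) (hind i)
  choose φ hφ using hφ
  have hφunit : ∀ i (y : (spanWords k PEmpty D U).primeCompl), IsUnit (φ i y) := fun i y => by
    rw [TrivSqZeroExt.isUnit_iff_isUnit_fst, (hφ i y).1, ← hχ]; exact hunitχ y
  let ψ : Fin n → (Localization.AtPrime (spanWords k PEmpty D U) →+* DualNumber k) := fun i => IsLocalization.lift (M := (spanWords k PEmpty D U).primeCompl) (hφunit i)
  have hψ : ∀ i a, ψ i (algebraMap _ _ a) = φ i a := fun i a => IsLocalization.lift_eq (hφunit i) a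
  let χR : Localization.AtPrime (spanWords k PEmpty D U) →+* k := IsLocalization.lift (M := (spanWords k PEmpty D U).primeCompl) hunitχ
  have hχR : ∀ a, χR (algebraMap _ _ a) = χ a := fun a => IsLocalization.lift_eq hunitχ a
  have hfstψ : ∀ i z, (ψ i z).fst = χR z := by
    intro i
    have hcomp : ((TrivSqZeroExt.fstHom k k k).toRingHom.comp (ψ i)) = χR := by
      refine IsLocalization.ringHom_ext (M := (spanWords k PEmpty D U).primeCompl) (RingHom.ext fun a => ?_)
      simp only [RingHom.coe_comp, Function.comp_apply, hψ, hχR, AlgHom.toRingHom_eq_coe, AlgHom.coe_toRingHom, TrivSqZeroExt.fstHom_apply]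
      rw [(hφ i a).1, hχ]
    intro z
    have := congrArg (fun f : Localization.AtPrime (spanWords k PEmpty D U) →+* k => f z) hcomp
    simpa using this
  have hχRmax : ∀ z ∈ maximalIdeal (Localization.AtPrime (spanWords k PEmpty D U)), χR z = 0 := by
    intro z hz
    rw [← Localization.AtPrime.map_eq_maximalIdeal] at hz
    have hle : (spanWords k PEmpty D U).map (algebraMap _ (Localization.AtPrime (spanWords k PEmpty D U))) ≤ RingHom.ker χR := by
      rw [Ideal.map_le_iff_le_comap]
      intro a ha
      rw [Ideal.mem_comap, RingHom.mem_ker, hχR]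
      exact h𝔪χ ha
    exact hle hz
  -- (3) the `k`-linear test `V z := (ε-part of ψ_i z)_i`
  obtain ⟨S, hScard, hSspan⟩ := Submodule.FG.exists_span_finset_card_eq_spanFinrank
    (IsNoetherian.noetherian (maximalIdeal (Localization.AtPrime (spanWords k PEmpty D U))))
  let V : Localization.AtPrime (spanWords k PEmpty D U) → (Fin n → k) := fun z i => (ψ i z).snd
  have hSmax : ∀ f ∈ S, f ∈ maximalIdeal (Localization.AtPrime (spanWords k PEmpty D U)) := fun f hf => hSspan ▸ Submodule.subset_span hf
  have hVmem : ∀ z ∈ maximalIdeal (Localization.AtPrime (spanWords k PEmpty D U)), V z ∈ Submodule.span k (V '' (S : Set _)) := by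
    intro z hz
    rw [← hSspan, Submodule.mem_span_finset] at hz
    obtain ⟨c, -, rfl⟩ := hz
    have hVsum : V (∑ f ∈ S, c f • f) = ∑ f ∈ S, χR (c f) • V f := by
      funext i
      simp only [V, Finset.sum_apply, Pi.smul_apply, smul_eq_mul, map_sum, TrivSqZeroExt.snd_sum]
      refine Finset.sum_congr rfl fun f hf => ?_
      rw [map_mul, DualNumber.snd_mul, hfstψ i, hfstψ i, hχRmax f (hSmax f hf), mul_zero, add_zero]
    rw [hVsum]
    exact Submodule.sum_mem _ fun f hf => Submodule.smul_mem _ _ (Submodule.subset_span ⟨f, hf, rfl⟩)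
  have hbasis : ∀ j : Fin n, (Pi.single j (1 : k) : Fin n → k) ∈ Submodule.span k (V '' (S : Set _)) := by
    intro j
    have hmemj : algebraMap (Ring k PEmpty D) (Localization.AtPrime (spanWords k PEmpty D U)) (wordElem k PEmpty D (U j)) ∈
        maximalIdeal (Localization.AtPrime (spanWords k PEmpty D U)) := by
      rw [← Localization.AtPrime.map_eq_maximalIdeal]
      exact Ideal.mem_map_of_mem _ (Ideal.subset_span ⟨j, rfl⟩)
    have hV : V (algebraMap _ _ (wordElem k PEmpty D (U j))) = Pi.single j 1 := by
      funext i
      simp only [V, hψ, (hφ i _).2, Pi.single_apply]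
      rw [theta_wordElem, xmon_eq_monomial, coeff_monomial]
      by_cases hij : i = j
      · subst hij; simp
      · rw [if_neg, if_neg hij]
        intro h0
        exact hij (hdist i j (ιexp_injective h0.symm))
    rw [← hV]
    exact hVmem _ hmemj
  have htop : (⊤ : Submodule k (Fin n → k)) ≤ Submodule.span k (V '' (S : Set _)) := by
    rw [← (Pi.basisFun k (Fin n)).span_eq, Submodule.span_le]
    rintro _ ⟨j, rfl⟩
    rw [Pi.basisFun_apply]
    exact hbasis j
  have hn : n ≤ S.card := by
    have h1 : Module.finrank k (Fin n → k) = n := Module.finrank_fin_fun k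
    have h2 : Module.finrank k (Submodule.span k (V '' (S : Set _))) ≤ (S.image V).card := by
      have := finrank_span_finset_le_card (R := k) (M := Fin n → k) (S.image V)
      rw [Finset.coe_image] at this
      exact this
    have h3 : (S.image V).card ≤ S.card := Finset.card_image_le
    have h4 : Module.finrank k (⊤ : Submodule k (Fin n → k)) ≤ Module.finrank k (Submodule.span k (V '' (S : Set _))) :=
      Submodule.finrank_mono htop
    rw [finrank_top, h1] at h4
    omega
  -- (4) regularity forces `card S = spanFinrank 𝔪A_𝔪 = dim A_𝔪 ≤ dim A = trdeg_k A ≤ d`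
  have hdimA : ∃ m : ℕ, ringKrullDim (Ring k PEmpty D) = m ∧ m ≤ d := by
    obtain ⟨m, hm, htr⟩ := exists_ringKrullDim_eq_and_trdeg_eq k (Ring k PEmpty D)
    refine ⟨m, hm, ?_⟩
    have hle : Algebra.trdeg k (Ring k PEmpty D) ≤ Algebra.trdeg k (MvPolynomial (Fin d ⊕ PEmpty) k) :=
      trdeg_le_of_injective (theta (k := k) (P := PEmpty) (D := D)) theta_injective
    rw [htr, MvPolynomial.trdeg_of_isDomain, Cardinal.mk_fintype, Fintype.card_sum, Fintype.card_fin] at hle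
    simpa using hle
  obtain ⟨m, hm, hmd⟩ := hdimA
  have hdimR : ringKrullDim (Localization.AtPrime (spanWords k PEmpty D U)) ≤ (m : WithBot ℕ∞) := by
    rw [IsLocalization.AtPrime.ringKrullDim_eq_height (spanWords k PEmpty D U) (Localization.AtPrime (spanWords k PEmpty D U))]
    have hh := Ideal.height_le_ringKrullDim_of_isPrime (I := spanWords k PEmpty D U)
    rw [hm] at hh
    exact hh
  have hsf := hreg.spanFinrank_maximalIdeal
  have hcard : (S.card : WithBot ℕ∞) ≤ (m : WithBot ℕ∞) := by
    rw [hScard, hsf]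
    exact hdimR
  have : S.card ≤ m := by exact_mod_cast hcard
  omega

end Summit.ResolutionOfSingularities.ResolutionOfSingularities.Theorems.FInjectiveMacaulayfication.ToricConePoint

end
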